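import Mathlib
import Summits.CriticalPhenomena.PercolationContinuityZ3.Theorems.PercNearOneGluingNoHeavyLowerTailMSSharp
import Summits.CriticalPhenomena.PercolationContinuityZ3.Theorems.PercNearOneGluingNoHeavyLowerTailTypedSectioningSymmetric

/-!
# MS♯ (hence K♯) from a sectioning certificate of the debtor-pair system (hp-7 gen 82)

Helper file for crux `stmt-CriticalPhenomena-4575` (`NoHeavyLowerTail`, route `PercNearOneGluingNoHeavy`), hull-port seat
`prim-hp-7` (generation 82); `--supports stmt-CriticalPhenomena-4575 --as helper`.  Pure finite set theory; everything is PROVED.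
Memo: `run/shared/lean/prim/prim-hp-7/FROM-prim-hp-7-g82-GENERAL-ALLOCATION.md` §0bis (J); note `HP7-SECT-HEXMS.md`.

`GeneratedDonors.MSSharp` (`…LowerTailMSSharp`, hp-7 g64) asks `#(debtors g h) ≤ 2 · #(genSharp g h)` for monotone labellings `g h : Finset α → Lab 3`
(the free form of a monotone map into the hexagon lattice); it implies Conjecture K♯ (`kSharp_of_msSharp`).  Here the typed-sectioning vehicle is attached:
with a base point `u₀`, the DEBTOR-PAIR SYSTEM has one minuend per complementary pair of debtor sets (representative avoiding `u₀`,
`TypedSectioning.crep univ u₀`) which may use the representatives of the generated differences `q \ s` of both members of its pair (`msA`).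
A certificate of this pair system gives the MS♯ inequality for `(g, h)` (`msSharp_ineq_of_pcert`), hence the K♯ inequality
(`kSharp_ineq_of_pcert`, via `kSharp_ineq_of_msSharp_ineq`).

Census (memo §0bis (J)): all 30 046 920 monotone maps on `2^[4]` (152 448 debtor signatures) are certified with the canonical Ahlswede–Daykin
children in some coordinate order (99.4 % in every order; all pure-labelled ones in every order); annealed K♯-tight instances `n ≤ 6` likewise.
-/

namespace Summit.CriticalPhenomena.PercolationContinuityZ3.Theorems

namespace TypedSectioning

open Finset GeneratedDonors OrientedAntipodalHall AntipodalStrongHarris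

variable {α : Type} [Fintype α] [DecidableEq α]

/-- The debtor-pair system of `(g, h)`: the representative `R` of a complementary pair containing a debtor set may use the representatives of
all generated differences `q \ s` with `q` a debtor set of that pair (`crep univ u₀ q = R`) and `s` a debtor set close to `q`. -/
def msA (u₀ : α) (g h : Finset α → Lab 3) : Finset α → Finset (Finset α) := fun R =>
  ((debtors g h).filter fun q => crep univ u₀ q = R).biUnion fun q =>
    (((debtors g h).filter fun s => Linked g h (univ \ q) s).image fun s => q \ s).image (crep univ u₀)

/-- The terms of the debtor-pair system are representatives of generated differences. -/
theorem pterms_msA_subset (u₀ : α) (g h : Finset α → Lab 3) :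
    pterms ((debtors g h).image (crep univ u₀)) (msA u₀ g h) ⊆ (genSharp g h).image (crep univ u₀) := by
  intro E hE
  obtain ⟨R, -, hER⟩ := mem_pterms.mp hE
  unfold msA at hER
  simp only [mem_biUnion, mem_filter, mem_image] at hER
  obtain ⟨q, ⟨hq, -⟩, t, ⟨s, ⟨hs, hl⟩, rfl⟩, rfl⟩ := hER
  exact mem_image.mpr ⟨q \ s, mem_genSharp.mpr ⟨q, hq, s, hs, hl, rfl⟩, rfl⟩

/-- Any family has at most twice as many members as complementary-pair representatives. -/
theorem card_le_two_mul_card_image_crep (u₀ : α) (𝒟 : Finset (Finset α)) :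
    #𝒟 ≤ 2 * #(𝒟.image (crep univ u₀)) := by
  classical
  refine card_le_mul_card_image 𝒟 2 (fun R _ => ?_)
  have hsub : (𝒟.filter fun a => crep univ u₀ a = R) ⊆ {R, univ \ R} := by
    intro a ha
    obtain ⟨-, haR⟩ := mem_filter.mp ha
    unfold crep at haR
    split_ifs at haR with hu
    · have : a = univ \ R := by rw [← haR, Finset.sdiff_sdiff_eq_self (subset_univ a)]
      rw [this]; simp
    · rw [haR]; simp
  exact (card_le_card hsub).trans (card_insert_le _ _) |>.trans (by simp)

/-- **MS♯ at `(g, h)` from a certificate** (hp-7 gen 82): if the debtor-pair system is certified for some base point `u₀`, then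
`#(debtors g h) ≤ 2 · #(genSharp g h)`. -/
theorem msSharp_ineq_of_pcert (g h : Finset α → Lab 3) (u₀ : α)
    (hcert : PCert ((debtors g h).image (crep univ u₀)) (msA u₀ g h)) :
    #(debtors g h) ≤ 2 * #(genSharp g h) := by
  have h1 := card_le_two_mul_card_image_crep u₀ (debtors g h)
  have h2 : #((debtors g h).image (crep univ u₀)) ≤ #((genSharp g h).image (crep univ u₀)) :=
    card_le_card_of_pcert hcert (pterms_msA_subset u₀ g h)
  have h3 : #((genSharp g h).image (crep univ u₀)) ≤ #(genSharp g h) := card_image_le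
  omega

/-- **K♯ at `(g, h)` from a certificate**: for monotone `g, h`, a certificate of the debtor-pair system gives the K♯ inequality
`#charged ≤ #credited` (`kSharp_ineq_of_msSharp_ineq`). -/
theorem kSharp_ineq_of_pcert (g h : Finset α → Lab 3)
    (hg : ∀ ⦃X Y : Finset α⦄, X ⊆ Y → g X ≤ g Y) (hh : ∀ ⦃X Y : Finset α⦄, X ⊆ Y → h X ≤ h Y) (u₀ : α)
    (hcert : PCert ((debtors g h).image (crep univ u₀)) (msA u₀ g h)) :
    #{q ∈ (univ : Finset (Finset α)) | IsCharged 3 g h q} ≤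
      #{q ∈ (univ : Finset (Finset α)) | (g q = Lab.top ∧ h (univ \ q) = Lab.bot) ∨ (g (univ \ q) = Lab.top ∧ h q = Lab.bot)} :=
  kSharp_ineq_of_msSharp_ineq g h hg hh (msSharp_ineq_of_pcert g h u₀ hcert)

end TypedSectioning

end Summit.CriticalPhenomena.PercolationContinuityZ3.Theorems
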